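import Summits.QuantumFields.YangMills.Theorems.ColdStartUniversalityLatticeLangevinAsymptoticVariance
import Summits.QuantumFields.YangMills.Theorems.ColdStartUniversalityLatticeLangevinWellPosed
import Summits.QuantumFields.YangMills.Theorems.ColdStartUniversalityColdStartSolutionsExistNoise
import HarnessLib

/-!
# Route `ColdStartUniversality` (fixed-cut-off SZZ dynamics): the Green–Kubo asymptotic variance is NON-NEGATIVE for every continuous observable

Helper file (seat `ym-line-csu-p1`, g34; `--supports stmt-QuantumFields-24809`).  A sanity companion of files 67 (asymptotic variance), 70–88
(concentration, batch means): the Green–Kubo integral `GK(G) = ∫₀^∞ ∫ Ĝ·κ_tĜ dμ_(β') dt` (`Ĝ = G − μ_(β')G`), i.e. half the asymptotic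
variance `σ²(G) = lim_T T⁻¹ E[(∫₀ᵀ Ĝ(U_r)dr)²]`, is `≥ 0` for EVERY continuous `|G| ≤ 1` and every realising kernel family — by the
probabilistic route: `E[(∫₀ᵀ Ĝ)²] ≥ 0` and `|E[(∫₀ᵀĜ)²] − 2T·GK| ≤ K` (file 67, along the canonical solution on the product Wiener space) for
all `T`, so `GK ≥ −K/(2T) → 0`.  (g16 proved strict positivity for smooth cylinder observables with positive Dirichlet energy by the spectral
route; here no smoothness is needed.)
* ★★ `greenKubo_nonneg` — `0 ≤ ∫₀^∞ ∫ Ĝ·κ_tĜ dμ_(β') dt`.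
THEOREMS ONLY, no definition, no sorry; [folklore].  HONEST FRAMING: fixed cut-off; `UniformColdStartMixing` (24809) is NOT restated; no crux, rung or
summit statement is proved; the Yang–Mills mass gap is NOT proved.
-/

set_option autoImplicit false

noncomputable section

namespace Summit.QuantumFields.YangMills.Theorems.ColdStartUniversality

open MeasureTheory ProbabilityTheory Filter Topology Set
open scoped NNReal ENNReal BigOperators
open Literature Literature.Probability.Process Literature.MathematicalPhysics.QuantumFieldTheory
open Literature.MathematicalPhysics.QuantumLattice (fundamentalRep fundamentalLatticeRep continuous_fundamentalRep)

variable {L : ℕ} [NeZero L]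

/-- ★★ **Non-negativity of the Green–Kubo asymptotic variance**: for every realising Markov kernel family `κ` of the SU(2) SZZ dynamics and
every continuous `G` with `|G| ≤ 1`, `0 ≤ ∫₀^∞ ∫ (G − μG)·κ_t(G − μG) dμ_(β') dt`. [folklore] -/
theorem greenKubo_nonneg (L : ℕ) [NeZero L] (β' : ℝ)
    (κ : ℝ≥0 → Kernel (GaugeConfig 3 L (Matrix.specialUnitaryGroup (Fin 2) ℂ))
      (GaugeConfig 3 L (Matrix.specialUnitaryGroup (Fin 2) ℂ))) [∀ t, IsMarkovKernel (κ t)]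
    (hreal : ∀ (t : ℝ≥0) (x : GaugeConfig 3 L (Matrix.specialUnitaryGroup (Fin 2) ℂ))
        (Ω : Type) [MeasurableSpace Ω] (P : Measure Ω) [IsProbabilityMeasure P]
        (W : ℝ≥0 → Ω → (Edge 3 L × NoiseIdx 2 → ℝ)) (hW : IsFlatBrownian W P)
        (U : ℝ≥0 → Ω → GaugeConfig 3 L (Matrix.specialUnitaryGroup (Fin 2) ℂ)),
        (∀ ω, U 0 ω = x) →
        (latticeLangevinDynamics (fundamentalLatticeRep 2) β').IsSolution (fundamentalRep (Fin 2))
          hW.natFiltration P W U →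
        κ t x = P.map (U t))
    {G : GaugeConfig 3 L (Matrix.specialUnitaryGroup (Fin 2) ℂ) → ℝ} (hG : Continuous G) (hG1 : ∀ z, |G z| ≤ 1) :
    0 ≤ ∫ t in Ioi (0 : ℝ), (∫ y, (G y - ∫ z, G z ∂(wilsonMeasure (d := 3) (L := L) (fundamentalRep (Fin 2)) β')) *
        (∫ z, (G z - ∫ z', G z' ∂(wilsonMeasure (d := 3) (L := L) (fundamentalRep (Fin 2)) β')) ∂(κ t.toNNReal y))
        ∂(wilsonMeasure (d := 3) (L := L) (fundamentalRep (Fin 2)) β')) := by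
  classical
  obtain ⟨K, hK, h67⟩ := abs_integral_sq_centered_sub_greenKubo_le_of_solution L β'
  -- a solution from the trivial start on the product Wiener space
  haveI := isProbabilityMeasure_piWiener (Edge 3 L × NoiseIdx 2)
  have hWc := isFlatBrownian_piWiener 3 L (NoiseIdx 2)
  obtain ⟨U, hU0, hU⟩ := solution_from_start hWc β' (fun _ => (1 : Matrix.specialUnitaryGroup (Fin 2) ℂ))
  set GK : ℝ := ∫ t in Ioi (0 : ℝ), (∫ y, (G y - ∫ z, G z ∂(wilsonMeasure (d := 3) (L := L) (fundamentalRep (Fin 2)) β')) *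
        (∫ z, (G z - ∫ z', G z' ∂(wilsonMeasure (d := 3) (L := L) (fundamentalRep (Fin 2)) β')) ∂(κ t.toNNReal y))
        ∂(wilsonMeasure (d := 3) (L := L) (fundamentalRep (Fin 2)) β')) with hGK
  by_contra hneg
  push Not at hneg
  -- take `T` with `2T·GK = −(K + 1)`
  set T : ℝ := (K + 1) / (-(2 * GK)) with hT
  have hT0 : 0 ≤ T := div_nonneg (by linarith) (by linarith)
  have h := h67 κ hreal _ _ _ _ hWc U hU0 hU G hG hG1 T hT0
  have hE : 0 ≤ ∫ ω, (∫ r in Ioc 0 T, (G (U r.toNNReal ω) - ∫ z, G z ∂(wilsonMeasure (d := 3) (L := L) (fundamentalRep (Fin 2)) β'))) ^ 2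
      ∂(Measure.pi fun _ : Edge 3 L × NoiseIdx 2 => preWienerMeasure) := integral_nonneg fun ω => sq_nonneg _
  have hGK0 : GK ≠ 0 := ne_of_lt hneg
  have h2T : 2 * T * GK = -(K + 1) := by rw [hT]; field_simp
  rw [h2T] at h
  have := (abs_le.1 h).2
  linarith

end Summit.QuantumFields.YangMills.Theorems.ColdStartUniversality

end
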